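import Mathlib.Analysis.SpecialFunctions.SmoothTransition
import Mathlib.Analysis.SpecialFunctions.Trigonometric.Deriv
import Mathlib.Analysis.SpecialFunctions.Pow.Real
import Mathlib.Analysis.SpecialFunctions.Log.Basic
import Mathlib.Analysis.Calculus.IteratedDeriv.Lemmas
import Mathlib.Analysis.Calculus.ContDiff.FTaylorSeries
import Mathlib.Analysis.Normed.Group.Bounded
import Mathlib.Analysis.Complex.RealDeriv
import Mathlib.Data.Int.Interval
import HarnessLib

/-!
# A constructed smooth geometric ("dyadic") partition of unity `∑_X ω(x/X)² = 1` on `(0, ∞)`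

Topic `Literature/NumberTheory/LFunctions`, namespace
`Literature.NumberTheory.LFunctions.SmoothDyadicPartition`. Generic calculus; everything here is a
CONSTRUCTION with proofs (two plumbing definitions, no named facts).

This is the "dyadic partition of unity of the form `∑_X ω(x/X)² = 1` in each variable … where `ω`
is a smooth function supported on `[1,2]` and where `X` varies over a dyadic sequence, `2^j` say"
of [BondarenkoHeap2026, §6.2, TeX l.750–753] (and of countless analytic-number-theory papers),
built explicitly so that it can be INSTANTIATED (Mathlib's `Real.smoothTransition`). Two remarks on
the printed phrase, which is loose: a continuous `ω` vanishing off `[1,2]` has `ω(1) = ω(2) = 0`,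
so with ratio-`2` scales the points `2^j` would be uncovered; one either takes `supp ω ⊆ [1/2, 2]`
or — as here, to fit the window `X ≤ x ≤ 2X` of the tree's `IsSmoothDyadicWeight`
(`BondarenkoHeap2026Section6.lean`) — keeps `supp ω ⊆ [1, 2]` and lets `X` run over the geometric
sequence of ratio `√2`, `X = √2^j` (`j ∈ ℤ`); the number of scales below a bound `Y` is still
`≪ log Y` (`exists_cover_index`).

Construction: `θ(x) = (π/2)·s((x−1)/(√2−1))` with `s` = `Real.smoothTransition` (so `θ = 0` for
`x ≤ 1`, `θ = π/2` for `x ≥ √2`, smooth, monotone), the plateau `P(x) = cos²θ(x)` (`= 1` on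
`x ≤ 1`, `= 0` on `x ≥ √2`), and the bump **`ω(x) = sin θ(x) · cos θ(x/√2)`** — one global smooth
formula with `ω² = P(x/√2) − P(x)` (`bump_sq_eq`), whence the telescoping identity
`∑_{j=a}^{b} ω(x/√2^j)² = P(x/√2^{b+1}) − P(x/√2^a) = 1` for `√2^{a+1} ≤ x ≤ √2^{b+1}`.

* `bump`, `bump_contDiff`, `bump_nonneg`, `bump_le_one`, `bump_eq_zero_of_le_one`,
  `bump_eq_zero_of_two_le`, `bump_ne_zero_imp` (`ω(x) ≠ 0 ⇒ 1 < x < 2`), `bump_div_ne_zero_imp`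
  (the window `X ≤ x ≤ 2X` for `ω(x/X)`), `tsupport_bump_subset`, `hasCompactSupport_bump`,
  `exists_bound_iteratedDeriv_bump` (each derivative bounded; complex-valued twin
  `exists_bound_iteratedDeriv_bump_ofReal`);
* `sum_range_bump_sq_eq` (telescoping), `sum_bump_sq_eq_one` (`ℤ`-window form),
  `sum_range_bump_sq_eq_one` (cover of `[1, √2^J]` by the scales `√2^{j−1}`, `0 ≤ j ≤ J`),
  `exists_cover_index` (`J ≤ 2 log Y/log 2 + 1` scales reach `Y`).

## References

* [BondarenkoHeap2026] A. Bondarenko, W. Heap, arXiv:2608.07399v1, §6.2 (TeX l.750–753) — the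
  use of such a partition; the construction itself is folklore (e.g. any treatment of smooth
  dyadic decompositions).
-/

noncomputable section

open Real Finset Set
open scoped ContDiff

namespace Literature.NumberTheory.LFunctions.SmoothDyadicPartition

/-! ### The angle `θ` and the plateau `P = cos² θ` -/

/-- The angle `θ(x) = (π/2) · s((x − 1)/(√2 − 1))`, `s` Mathlib's smooth transition: `θ = 0` for
`x ≤ 1`, `θ = π/2` for `x ≥ √2`, smooth and monotone. (Plumbing for `bump`.) [folklore] -/
def theta (x : ℝ) : ℝ :=
  π / 2 * Real.smoothTransition ((x - 1) / (Real.sqrt 2 - 1))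

/-- `√2 − 1 > 0`. [folklore] -/
private theorem sqrt_two_sub_one_pos : 0 < Real.sqrt 2 - 1 := by
  have := Real.one_lt_sqrt_two; linarith

/-- `θ` is smooth. [cite: BondarenkoHeap2026, §6.2, TeX l.750–753] -/
theorem theta_contDiff : ContDiff ℝ ∞ theta :=
  contDiff_const.mul (Real.smoothTransition.contDiff.comp
    ((contDiff_id.sub contDiff_const).div_const _))

/-- `θ ≥ 0`. [cite: BondarenkoHeap2026, §6.2, TeX l.750–753] -/
theorem theta_nonneg (x : ℝ) : 0 ≤ theta x :=
  mul_nonneg (by positivity) (Real.smoothTransition.nonneg _)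

/-- `θ ≤ π/2`. [cite: BondarenkoHeap2026, §6.2, TeX l.750–753] -/
theorem theta_le (x : ℝ) : theta x ≤ π / 2 := by
  have h := Real.smoothTransition.le_one ((x - 1) / (Real.sqrt 2 - 1))
  have hπ : 0 < π / 2 := by positivity
  calc theta x ≤ π / 2 * 1 := mul_le_mul_of_nonneg_left h hπ.le
    _ = π / 2 := mul_one _

/-- `θ(x) = 0` for `x ≤ 1`. [cite: BondarenkoHeap2026, §6.2, TeX l.750–753] -/
theorem theta_eq_zero {x : ℝ} (hx : x ≤ 1) : theta x = 0 := by
  rw [theta, Real.smoothTransition.zero_of_nonpos, mul_zero]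
  exact div_nonpos_of_nonpos_of_nonneg (by linarith) sqrt_two_sub_one_pos.le

/-- `θ(x) = π/2` for `x ≥ √2`. [cite: BondarenkoHeap2026, §6.2, TeX l.750–753] -/
theorem theta_eq_pi_div_two {x : ℝ} (hx : Real.sqrt 2 ≤ x) : theta x = π / 2 := by
  rw [theta, Real.smoothTransition.one_of_one_le, mul_one]
  rw [le_div_iff₀ sqrt_two_sub_one_pos]; linarith

/-- `θ` is monotone. [cite: BondarenkoHeap2026, §6.2, TeX l.750–753] -/
theorem theta_monotone : Monotone theta := fun x y hxy =>
  mul_le_mul_of_nonneg_left (Real.smoothTransition.monotone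
    (div_le_div_of_nonneg_right (by linarith) sqrt_two_sub_one_pos.le)) (by positivity)

/-- The plateau `P(x) = cos² θ(x)`: `1` for `x ≤ 1`, `0` for `x ≥ √2`. (Plumbing.) [folklore] -/
def plateau (x : ℝ) : ℝ :=
  Real.cos (theta x) ^ 2

/-- `P(x) = 1` for `x ≤ 1`. [cite: BondarenkoHeap2026, §6.2, TeX l.750–753] -/
theorem plateau_eq_one {x : ℝ} (hx : x ≤ 1) : plateau x = 1 := by
  rw [plateau, theta_eq_zero hx, Real.cos_zero, one_pow]

/-- `P(x) = 0` for `x ≥ √2`. [cite: BondarenkoHeap2026, §6.2, TeX l.750–753] -/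
theorem plateau_eq_zero {x : ℝ} (hx : Real.sqrt 2 ≤ x) : plateau x = 0 := by
  rw [plateau, theta_eq_pi_div_two hx, Real.cos_pi_div_two]; ring

/-- `P ≥ 0`. [cite: BondarenkoHeap2026, §6.2, TeX l.750–753] -/
theorem plateau_nonneg (x : ℝ) : 0 ≤ plateau x := sq_nonneg _

/-- `P ≤ 1`. [cite: BondarenkoHeap2026, §6.2, TeX l.750–753] -/
theorem plateau_le_one (x : ℝ) : plateau x ≤ 1 := by
  rw [plateau, sq_le_one_iff_abs_le_one]; exact Real.abs_cos_le_one _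

/-! ### The bump `ω(x) = sin θ(x) · cos θ(x/√2)` -/

/-- **The bump** `ω(x) = sin θ(x) · cos θ(x/√2)`: smooth, `0 ≤ ω ≤ 1`, `ω = 0` off `(1, 2)`, and
`ω(x)² = P(x/√2) − P(x)` telescopes along the scales `√2^j`.
[cite: BondarenkoHeap2026, §6.2, TeX l.750–753] -/
def bump (x : ℝ) : ℝ :=
  Real.sin (theta x) * Real.cos (theta (x / Real.sqrt 2))

/-- `ω` is smooth. [cite: BondarenkoHeap2026, §6.2, TeX l.750–753] -/
theorem bump_contDiff : ContDiff ℝ ∞ bump :=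
  (Real.contDiff_sin.comp theta_contDiff).mul
    (Real.contDiff_cos.comp (theta_contDiff.comp (contDiff_id.div_const _)))

/-- `ω ≥ 0`. [cite: BondarenkoHeap2026, §6.2, TeX l.750–753] -/
theorem bump_nonneg (x : ℝ) : 0 ≤ bump x := by
  unfold bump
  refine mul_nonneg ?_ ?_
  · exact Real.sin_nonneg_of_nonneg_of_le_pi (theta_nonneg x)
      ((theta_le x).trans (by linarith [Real.pi_pos]))
  · exact Real.cos_nonneg_of_neg_pi_div_two_le_of_le
      (by linarith [theta_nonneg (x / Real.sqrt 2), Real.pi_pos]) (theta_le _)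

/-- `ω ≤ 1`. [cite: BondarenkoHeap2026, §6.2, TeX l.750–753] -/
theorem bump_le_one (x : ℝ) : bump x ≤ 1 := by
  unfold bump
  have h1 : Real.sin (theta x) ≤ 1 := Real.sin_le_one _
  have h2 : Real.cos (theta (x / Real.sqrt 2)) ≤ 1 := Real.cos_le_one _
  have h3 : 0 ≤ Real.cos (theta (x / Real.sqrt 2)) :=
    Real.cos_nonneg_of_neg_pi_div_two_le_of_le
      (by linarith [theta_nonneg (x / Real.sqrt 2), Real.pi_pos]) (theta_le _)
  nlinarith

/-- `ω(x) = 0` for `x ≤ 1`. [cite: BondarenkoHeap2026, §6.2, TeX l.750–753] -/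
theorem bump_eq_zero_of_le_one {x : ℝ} (hx : x ≤ 1) : bump x = 0 := by
  rw [bump, theta_eq_zero hx, Real.sin_zero, zero_mul]

/-- `ω(x) = 0` for `x ≥ 2` (as `2/√2 = √2`). [cite: BondarenkoHeap2026, §6.2, TeX l.750–753] -/
theorem bump_eq_zero_of_two_le {x : ℝ} (hx : 2 ≤ x) : bump x = 0 := by
  have hs : 0 < Real.sqrt 2 := Real.sqrt_pos.mpr two_pos
  have h : Real.sqrt 2 ≤ x / Real.sqrt 2 := by
    rw [le_div_iff₀ hs, Real.mul_self_sqrt two_pos.le]; exact hx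
  rw [bump, theta_eq_pi_div_two h, Real.cos_pi_div_two, mul_zero]

/-- **Support**: `ω(x) ≠ 0 ⇒ 1 < x < 2`. [cite: BondarenkoHeap2026, §6.2, TeX l.750–753] -/
theorem bump_ne_zero_imp {x : ℝ} (h : bump x ≠ 0) : 1 < x ∧ x < 2 := by
  by_contra hc
  rw [not_and_or, not_lt, not_lt] at hc
  rcases hc with hc | hc
  · exact h (bump_eq_zero_of_le_one hc)
  · exact h (bump_eq_zero_of_two_le hc)

/-- The window of the scaled bump: for `X > 0`, `ω(x/X) ≠ 0 ⇒ X ≤ x ≤ 2X` (the support clause of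
the tree's `IsSmoothDyadicWeight X …`). [cite: BondarenkoHeap2026, §6.2, TeX l.834–836] -/
theorem bump_div_ne_zero_imp {X x : ℝ} (hX : 0 < X) (h : bump (x / X) ≠ 0) : X ≤ x ∧ x ≤ 2 * X := by
  obtain ⟨h1, h2⟩ := bump_ne_zero_imp h
  rw [lt_div_iff₀ hX] at h1
  rw [div_lt_iff₀ hX] at h2
  constructor <;> linarith

/-- `tsupport ω ⊆ [1, 2]`. [cite: BondarenkoHeap2026, §6.2, TeX l.750–753] -/
theorem tsupport_bump_subset : tsupport bump ⊆ Set.Icc 1 2 := by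
  refine closure_minimal ?_ isClosed_Icc
  intro x hx
  obtain ⟨h1, h2⟩ := bump_ne_zero_imp (Function.mem_support.mp hx)
  exact ⟨h1.le, h2.le⟩

/-- `ω` has compact support. [cite: BondarenkoHeap2026, §6.2, TeX l.750–753] -/
theorem hasCompactSupport_bump : HasCompactSupport bump :=
  (isCompact_Icc (a := (1 : ℝ)) (b := 2)).of_isClosed_subset (isClosed_tsupport _)
    tsupport_bump_subset

/-- **Each derivative of `ω` is bounded** ("`‖ω^{(j)}‖_∞ ≪_j 1`", so that `x ↦ ω(x/X)` has `j`-th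
derivative `≪_j X^{−j}`). [cite: BondarenkoHeap2026, §6.2, TeX l.834–836] -/
theorem exists_bound_iteratedDeriv_bump (j : ℕ) :
    ∃ C : ℝ, 0 ≤ C ∧ ∀ x : ℝ, ‖iteratedDeriv j bump x‖ ≤ C := by
  have hc : Continuous (iteratedDeriv j bump) :=
    bump_contDiff.continuous_iteratedDeriv j (by exact_mod_cast le_top)
  have hsupp : HasCompactSupport (iteratedDeriv j bump) := by
    refine (hasCompactSupport_bump.iteratedFDeriv (𝕜 := ℝ) j).mono ?_
    intro x hx
    rw [Function.mem_support] at hx ⊢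
    intro h0
    apply hx
    simp [iteratedDeriv_eq_iteratedFDeriv, h0]
  obtain ⟨C, hC⟩ := hc.bounded_above_of_compact_support hsupp
  exact ⟨max C 0, le_max_right _ _, fun x => (hC x).trans (le_max_left _ _)⟩

/-- The complex-valued bump `x ↦ (ω(x) : ℂ)` is smooth. [cite: BondarenkoHeap2026, §6.2, TeX l.750–753] -/
theorem bump_contDiff_ofReal : ContDiff ℝ ∞ fun x : ℝ => (bump x : ℂ) :=
  Complex.ofRealCLM.contDiff.comp bump_contDiff

/-- Iterated derivatives commute with the embedding `ℝ → ℂ` for a smooth real function. [folklore] -/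
private theorem iteratedDeriv_ofReal_comp {f : ℝ → ℝ} (hf : ContDiff ℝ ∞ f) (j : ℕ) (x : ℝ) :
    iteratedDeriv j (fun y : ℝ => (f y : ℂ)) x = ((iteratedDeriv j f x : ℝ) : ℂ) := by
  induction j generalizing f x with
  | zero => simp
  | succ j ih =>
    rw [iteratedDeriv_succ', iteratedDeriv_succ']
    have hd : ∀ y, HasDerivAt f (deriv f y) y := fun y =>
      (hf.differentiable (by simp)).differentiableAt.hasDerivAt
    have hderiv : deriv (fun y : ℝ => (f y : ℂ)) = fun y => ((deriv f y : ℝ) : ℂ) := by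
      funext y
      exact (hd y).ofReal_comp.deriv
    rw [hderiv]
    exact ih (contDiff_infty_iff_deriv.1 hf).2 x

/-- Each derivative of the complex-valued bump is bounded. [cite: BondarenkoHeap2026, §6.2, TeX l.834–836] -/
theorem exists_bound_iteratedDeriv_bump_ofReal (j : ℕ) :
    ∃ C : ℝ, 0 ≤ C ∧ ∀ x : ℝ, ‖iteratedDeriv j (fun y : ℝ => (bump y : ℂ)) x‖ ≤ C := by
  obtain ⟨C, hC0, hC⟩ := exists_bound_iteratedDeriv_bump j
  refine ⟨C, hC0, fun x => ?_⟩
  rw [iteratedDeriv_ofReal_comp bump_contDiff, Complex.norm_real]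
  exact hC x

/-! ### The square identity and the telescoping partition -/

/-- **`ω(x)² = P(x/√2) − P(x)`**: on `x < √2` one has `P(x/√2) = 1` and `ω² = sin²θ(x) = 1 − P(x)`;
on `x ≥ √2`, `P(x) = 0` and `ω² = cos²θ(x/√2) = P(x/√2)`. [cite: BondarenkoHeap2026, §6.2, TeX l.750–753] -/
theorem bump_sq_eq (x : ℝ) : bump x ^ 2 = plateau (x / Real.sqrt 2) - plateau x := by
  have hs : 0 < Real.sqrt 2 := Real.sqrt_pos.mpr two_pos
  have hkey : plateau x * plateau (x / Real.sqrt 2) = plateau x := by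
    rcases le_or_gt (Real.sqrt 2) x with h | h
    · rw [plateau_eq_zero h, zero_mul]
    · have : x / Real.sqrt 2 ≤ 1 := by
        rw [div_le_one hs]; exact h.le
      rw [plateau_eq_one this, mul_one]
  have hsin : Real.sin (theta x) ^ 2 = 1 - plateau x := by
    rw [plateau, Real.sin_sq]
  calc bump x ^ 2 = Real.sin (theta x) ^ 2 * plateau (x / Real.sqrt 2) := by
        rw [bump, mul_pow, plateau]
    _ = (1 - plateau x) * plateau (x / Real.sqrt 2) := by rw [hsin]
    _ = plateau (x / Real.sqrt 2) - plateau x * plateau (x / Real.sqrt 2) := by ring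
    _ = plateau (x / Real.sqrt 2) - plateau x := by rw [hkey]

/-- **Telescoping**: `∑_{i<n} ω(x/√2^{a+i})² = P(x/√2^{a+n}) − P(x/√2^{a})` (`a ∈ ℤ`, scales as
integer powers of `√2`). [cite: BondarenkoHeap2026, §6.2, TeX l.750–753] -/
theorem sum_range_bump_sq_eq (x : ℝ) (a : ℤ) (n : ℕ) :
    ∑ i ∈ Finset.range n, bump (x / Real.sqrt 2 ^ (a + i)) ^ 2 =
      plateau (x / Real.sqrt 2 ^ (a + n)) - plateau (x / Real.sqrt 2 ^ a) := by
  have hs : (Real.sqrt 2 : ℝ) ≠ 0 := (Real.sqrt_pos.mpr two_pos).ne'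
  have hstep : ∀ i : ℕ, bump (x / Real.sqrt 2 ^ (a + i)) ^ 2 =
      plateau (x / Real.sqrt 2 ^ (a + (i + 1 : ℕ))) - plateau (x / Real.sqrt 2 ^ (a + i)) := by
    intro i
    rw [bump_sq_eq]
    congr 2
    rw [div_div, ← zpow_add_one₀ hs]
    push_cast
    ring_nf
  simp_rw [hstep]
  rw [Finset.sum_range_sub (fun i : ℕ => plateau (x / Real.sqrt 2 ^ (a + (i : ℤ))))]
  simp

/-- **The smooth partition of unity, `ℤ`-window form**: for `√2^{a+1} ≤ x ≤ √2^{b+1}`,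
`∑_{j=a}^{b} ω(x/√2^j)² = 1` (only the scales `√2^j < x < 2·√2^j` contribute).
[cite: BondarenkoHeap2026, §6.2, TeX l.750–753] -/
theorem sum_bump_sq_eq_one {x : ℝ} {a b : ℤ} (ha : Real.sqrt 2 ^ (a + 1) ≤ x)
    (hb : x ≤ Real.sqrt 2 ^ (b + 1)) :
    ∑ j ∈ Finset.Icc a b, bump (x / Real.sqrt 2 ^ j) ^ 2 = 1 := by
  have hs1 : (1 : ℝ) < Real.sqrt 2 := Real.one_lt_sqrt_two
  have hs : (0 : ℝ) < Real.sqrt 2 := by linarith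
  have hab : a ≤ b := by
    have h := ha.trans hb
    have := (zpow_le_zpow_iff_right₀ hs1).mp h
    omega
  rw [Int.Icc_eq_finset_map, Finset.sum_map]
  have hn : ((b + 1 - a).toNat : ℤ) = b + 1 - a := Int.toNat_of_nonneg (by omega)
  have h := sum_range_bump_sq_eq x a (b + 1 - a).toNat
  simp only [Function.Embedding.trans_apply, Nat.castEmbedding_apply, addLeftEmbedding_apply]
  rw [h, hn, show a + (b + 1 - a) = b + 1 by ring]
  have htop : plateau (x / Real.sqrt 2 ^ (b + 1)) = 1 := by
    apply plateau_eq_one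
    rw [div_le_one (zpow_pos hs _)]; exact hb
  have hbot : plateau (x / Real.sqrt 2 ^ a) = 0 := by
    apply plateau_eq_zero
    rw [le_div_iff₀ (zpow_pos hs _), mul_comm, ← zpow_add_one₀ hs.ne']
    exact ha
  rw [htop, hbot, sub_zero]

/-- **Cover of `[1, Y]` by the scales `X_j = √2^{j−1}`, `0 ≤ j ≤ J`** (the piece `j = 0`, of scale
`1/√2`, is the one that covers `x = 1`): for `1 ≤ x ≤ √2^J`, `∑_{j=0}^{J} ω(x/√2^{j−1})² = 1`.
[cite: BondarenkoHeap2026, §6.2, TeX l.750–753] -/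
theorem sum_range_bump_sq_eq_one {x : ℝ} {J : ℕ} (h1 : 1 ≤ x) (hJ : x ≤ Real.sqrt 2 ^ J) :
    ∑ j ∈ Finset.range (J + 1), bump (x / Real.sqrt 2 ^ ((j : ℤ) - 1)) ^ 2 = 1 := by
  have hs1 : (1 : ℝ) < Real.sqrt 2 := Real.one_lt_sqrt_two
  have hs : (0 : ℝ) < Real.sqrt 2 := by linarith
  have h := sum_range_bump_sq_eq x (-1) (J + 1)
  have hre : ∀ j : ℕ, (j : ℤ) - 1 = -1 + j := fun j => by ring
  simp_rw [hre]
  rw [h]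
  have htop : plateau (x / Real.sqrt 2 ^ (-1 + ((J + 1 : ℕ) : ℤ))) = 1 := by
    apply plateau_eq_one
    have : (-1 : ℤ) + ((J + 1 : ℕ) : ℤ) = (J : ℤ) := by push_cast; ring
    rw [this, zpow_natCast, div_le_one (pow_pos hs _)]
    exact hJ
  have hbot : plateau (x / Real.sqrt 2 ^ (-1 : ℤ)) = 0 := by
    apply plateau_eq_zero
    rw [zpow_neg_one, div_inv_eq_mul]
    nlinarith
  rw [htop, hbot, sub_zero]

/-- **Number of scales**: for `Y ≥ 1` there is `J ≤ 2 log Y/log 2 + 1` with `Y ≤ √2^J` (so the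
cover of `[1, Y]` uses `J + 1 ≪ log Y` pieces). [cite: BondarenkoHeap2026, §6.2, TeX l.750–753] -/
theorem exists_cover_index {Y : ℝ} (hY : 1 ≤ Y) :
    ∃ J : ℕ, Y ≤ Real.sqrt 2 ^ J ∧ (J : ℝ) ≤ 2 * Real.log Y / Real.log 2 + 1 := by
  have hs : (0 : ℝ) < Real.sqrt 2 := Real.sqrt_pos.mpr two_pos
  have hlog2 : 0 < Real.log 2 := Real.log_pos one_lt_two
  have hlogs : Real.log (Real.sqrt 2) = Real.log 2 / 2 := by
    rw [Real.sqrt_eq_rpow, Real.log_rpow two_pos]; ring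
  have hY0 : 0 < Y := by linarith
  have hlogY : 0 ≤ Real.log Y := Real.log_nonneg hY
  set t : ℝ := 2 * Real.log Y / Real.log 2 with ht
  have ht0 : 0 ≤ t := by positivity
  refine ⟨⌈t⌉₊, ?_, ?_⟩
  · rw [← Real.log_le_log_iff hY0 (pow_pos hs _), Real.log_pow, hlogs]
    have h1 : t ≤ ⌈t⌉₊ := Nat.le_ceil t
    have h2 : Real.log Y = t * (Real.log 2 / 2) := by rw [ht]; field_simp
    rw [h2]
    exact mul_le_mul_of_nonneg_right h1 (by positivity)
  · exact (Nat.ceil_lt_add_one ht0).le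

/-! ### Appended: inserting the partition into a finite sum ("we first apply a dyadic partition
of unity … in each variable", TeX l.751) -/

/-- **Insertion of the partition into a finite sum**: if every index `n ∈ s` has
`1 ≤ n ≤ √2^J` (as reals), then `∑_{n ∈ s} F(n) = ∑_{j=0}^{J} ∑_{n ∈ s} ω(n/√2^{j−1})² · F(n)` —
one smooth piece per scale `X_j = √2^{j−1}`. Apply once per variable for the three-fold partition
in `k, m, r`. [cite: BondarenkoHeap2026, §6.2, TeX l.750–753] -/
theorem sum_eq_sum_range_bump_sq_mul {M : Type*} [AddCommMonoid M] [Module ℝ M] (s : Finset ℕ)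
    (F : ℕ → M) {J : ℕ} (hs : ∀ n ∈ s, (1 : ℝ) ≤ n ∧ (n : ℝ) ≤ Real.sqrt 2 ^ J) :
    ∑ n ∈ s, F n =
      ∑ j ∈ Finset.range (J + 1), ∑ n ∈ s, bump ((n : ℝ) / Real.sqrt 2 ^ ((j : ℤ) - 1)) ^ 2 • F n := by
  rw [Finset.sum_comm]
  refine Finset.sum_congr rfl fun n hn => ?_
  rw [← Finset.sum_smul, sum_range_bump_sq_eq_one (hs n hn).1 (hs n hn).2, one_smul]

/-- The real-valued (or complex-valued, via `smul = mul`) form: for `F : ℕ → ℝ`,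
`∑_{n ∈ s} F(n) = ∑_{j ≤ J} ∑_{n ∈ s} ω(n/√2^{j−1})² F(n)`. [cite: BondarenkoHeap2026, §6.2, TeX l.750–753] -/
theorem sum_eq_sum_range_bump_sq_mul_real (s : Finset ℕ) (F : ℕ → ℝ) {J : ℕ}
    (hs : ∀ n ∈ s, (1 : ℝ) ≤ n ∧ (n : ℝ) ≤ Real.sqrt 2 ^ J) :
    ∑ n ∈ s, F n =
      ∑ j ∈ Finset.range (J + 1), ∑ n ∈ s, bump ((n : ℝ) / Real.sqrt 2 ^ ((j : ℤ) - 1)) ^ 2 * F n := by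
  simpa only [smul_eq_mul] using sum_eq_sum_range_bump_sq_mul s F hs

/-- The complex-valued form: for `F : ℕ → ℂ`,
`∑_{n ∈ s} F(n) = ∑_{j ≤ J} ∑_{n ∈ s} (ω(n/√2^{j−1})² : ℂ) F(n)`. [cite: BondarenkoHeap2026, §6.2, TeX l.750–753] -/
theorem sum_eq_sum_range_bump_sq_mul_complex (s : Finset ℕ) (F : ℕ → ℂ) {J : ℕ}
    (hs : ∀ n ∈ s, (1 : ℝ) ≤ n ∧ (n : ℝ) ≤ Real.sqrt 2 ^ J) :
    ∑ n ∈ s, F n =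
      ∑ j ∈ Finset.range (J + 1), ∑ n ∈ s,
        ((bump ((n : ℝ) / Real.sqrt 2 ^ ((j : ℤ) - 1)) ^ 2 : ℝ) : ℂ) * F n := by
  have h := sum_eq_sum_range_bump_sq_mul s F hs
  simpa only [Complex.real_smul] using h

/-- **The cover of `[1, N]` for a natural number `N ≥ 1`**: every `n ∈ Icc 1 N` satisfies
`1 ≤ n ≤ √2^J` for the `J ≤ 2 log N/log 2 + 1` of `exists_cover_index`.
[cite: BondarenkoHeap2026, §6.2, TeX l.750–753] -/
theorem exists_cover_index_Icc {N : ℕ} (hN : 1 ≤ N) :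
    ∃ J : ℕ, (J : ℝ) ≤ 2 * Real.log N / Real.log 2 + 1 ∧
      ∀ n ∈ Finset.Icc 1 N, (1 : ℝ) ≤ n ∧ (n : ℝ) ≤ Real.sqrt 2 ^ J := by
  have hN1 : (1 : ℝ) ≤ N := by exact_mod_cast hN
  obtain ⟨J, hJ, hJle⟩ := exists_cover_index hN1
  refine ⟨J, hJle, fun n hn => ?_⟩
  obtain ⟨h1, h2⟩ := Finset.mem_Icc.mp hn
  exact ⟨by exact_mod_cast h1, le_trans (by exact_mod_cast h2) hJ⟩

end Literature.NumberTheory.LFunctions.SmoothDyadicPartition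

end
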